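import Summits.ABC.IUTFork.LanaLogLinkFrobeniusSubfield
import HarnessLib

/-!
# L-LANA objects VI quinquies: LANA's printed `I_v ⊂ K̄_v` IS the (HF) log-shell of `K_v`, embedded (proof-only bridge)

Proof-only file (D-0012; seat abc-iut-c312-4, L-LANA level, plan/LLANA-SPEC N10 "(HF)/(MF) DEFINE") closing the
avatar list of LANA's log-shell at a nonarchimedean place, for every finite `K_v = E ⊆ ℚ̄_p`; TAKES NO SIDE on
[IUTchIII] Cor. 3.12. The tree now has, for the SAME printed object `I_v`:

* gen 2's `logShellHF p E = (2p)⁻¹ • log_p(O^×_E) ⊆ E` (`LanaLogShellHF.lean`, over abc-iut-S1's real `unitLog`), shown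
  there to contain `O_E` and to equal [AbsTopIII] Def. 5.4 (iii)'s `ℐ_E` for `p = 2` / contain it for odd `p`;
* gen 0's multiplicative (MF) shell `logShellMF ⊆ O^{×μ}_{ℚ̄_p}` (`LanaLogShell.lean`);
* gen 4's `printedLogShellOf p E = (2p)⁻¹ · log((O^×_{ℚ̄_p})^{Gal(ℚ̄_p/E)}) ⊂ ℚ̄_p` (`LanaLogLinkFrobeniusSubfield.lean`, the
  display of LANA p. 26 inside `K̄_v`, over L4's Iwasawa logarithm), with (MF) `↦` `I_v` under `log` PROVED there.

THIS file proves the remaining identification **`printedLogShellOf p E = E ↪ ℚ̄_p '' logShellHF p E`**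
(`coe_printedLogShellOf_eq_image_logShellHF`): the `K̄_v`-level printed shell (Galois-invariant units, Iwasawa `log`
of `ℚ̄_p`) is exactly the `K_v`-level (HF) shell (units of `E`, abc-iut-S1's `unitLog`) pushed into `ℚ̄_p` — via
`(O^×_{ℚ̄_p})^{Gal(ℚ̄_p/E)} = O^×_E` (`unitInv_subfield_iff`) and the compatibility of the two real logarithms
(abc-iut-S1's `coe_unitLog_eq_padicLogAlgCl`). Hence LANA §5.1's (HF), (MF) and the p. 26 display name ONE object in
the tree, itself tied to [AbsTopIII] Def. 5.4 (iii) / [IUTchIII] Def. 1.1 (i) by `GaloisPadicLogShellBridge.lean` (L4)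
and `logShellHF_two_eq` / `logShell_ofUnitLog_subset_logShellHF` (gen 2). [cite: LANA2026Report, §5.1 pp. 26–27]
[cite: MochizukiAbsTopIII2015, Def 5.4 (iii) p. 126] NOT here: any judgement.
-/

noncomputable section

namespace Summit.ABC
namespace IUTFork

open Literature.AnabelianGeometry.AbsoluteAnabelian Literature.IUT.LogVolume
open Literature.NumberTheory.Transcendental (padicLogAlgCl)
open scoped NNReal Pointwise

variable (p : ℕ) [Fact p.Prime] (E : IntermediateField ℚ_[p] (PadicAlgCl p)) [FiniteDimensional ℚ_[p] E]

omit [FiniteDimensional ℚ_[p] E] in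
/-- `2p ≠ 0` in `E`. [folklore] -/
theorem two_mul_p_ne_zero_subfield : ((2 * p : ℕ) : E) ≠ 0 := by
  intro h
  have h' := congrArg (fun e : E => (e : PadicAlgCl p)) h
  simp only [Nat.cast_mul, Nat.cast_ofNat] at h'
  apply two_mul_p_ne_zero p
  push_cast at h' ⊢
  simpa using h'

/-- **LANA's printed `I_v ⊂ K̄_v` IS the (HF) log-shell of `K_v = E`, embedded in `K̄_v = ℚ̄_p`** (PROVED): for every
finite `E ⊆ ℚ̄_p`, `(2p)⁻¹ · log((O^×_{ℚ̄_p})^{Gal(ℚ̄_p/E)}) = ι_E((2p)⁻¹ · log_p(O^×_E))`.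
[cite: LANA2026Report, §5.1 p. 26, §5.1 (a) p. 27] -/
theorem coe_printedLogShellOf_eq_image_logShellHF :
    (printedLogShellOf p E : Set (PadicAlgCl p)) = algebraMap E (PadicAlgCl p) '' logShellHF p E := by
  ext y
  rw [SetLike.mem_coe, mem_printedLogShellOf_iff]
  constructor
  · rintro ⟨u, hu, huy⟩
    -- the invariant unit is `E`-rational
    have huE : ((u : (PadicAlgCl p)ˣ) : PadicAlgCl p) ∈ E := (unitInv_subfield_iff p E u).mp hu
    let uE : E := ⟨_, huE⟩
    have hu1 : ‖uE‖ = 1 := norm_eq_one_of_mem_unitGrp p u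
    refine ⟨(((2 * p : ℕ) : E))⁻¹ * unitLog uE, (mem_logShellHF_iff p E _).mpr ⟨uE, hu1, rfl⟩, ?_⟩
    -- push through `ι_E`, using the compatibility of the two logarithms
    have hc : algebraMap E (PadicAlgCl p) (unitLog uE) = padicLogAlgCl p ((u : (PadicAlgCl p)ˣ) : PadicAlgCl p) :=
      coe_unitLog_eq_padicLogAlgCl p E hu1
    rw [map_mul, map_inv₀, map_natCast, hc, ← huy, ← mul_assoc, inv_mul_cancel₀ (two_mul_p_ne_zero p), one_mul]
  · rintro ⟨z, hz, rfl⟩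
    obtain ⟨uE, hu1, rfl⟩ := (mem_logShellHF_iff p E z).mp hz
    have hu1' : ‖(uE : PadicAlgCl p)‖ = 1 := hu1
    let U : unitGrp (padicVal p) := ⟨_, mem_unitGrp_of_norm_eq_one p hu1'⟩
    have hUval : ((U : (PadicAlgCl p)ˣ) : PadicAlgCl p) = (uE : PadicAlgCl p) := rfl
    have hc : algebraMap E (PadicAlgCl p) (unitLog uE) = padicLogAlgCl p (uE : PadicAlgCl p) :=
      coe_unitLog_eq_padicLogAlgCl p E hu1
    refine ⟨U, (unitInv_subfield_iff p E U).mpr (by rw [hUval]; exact uE.2), ?_⟩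
    rw [hUval, map_mul, map_inv₀, map_natCast, hc, ← mul_assoc, mul_inv_cancel₀ (two_mul_p_ne_zero p), one_mul]

/-- Consequently gen 2's finite-level statement `O_E ⊆ logShellHF p E` and gen 4's `K̄_v`-level `O_E ⊆ I_v` are the same
fact; e.g. the `K̄_v`-level shell contains the image of the closed unit ball of `E` (re-derived through the bridge
from gen 2's `closedBall_subset_logShellHF`). [cite: LANA2026Report, §5.1 p. 26] -/
theorem image_closedBall_subset_printedLogShellOf :
    algebraMap E (PadicAlgCl p) '' Metric.closedBall (0 : E) 1 ⊆ (printedLogShellOf p E : Set (PadicAlgCl p)) := by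
  rw [coe_printedLogShellOf_eq_image_logShellHF]
  exact Set.image_mono (closedBall_subset_logShellHF p E)

end IUTFork

end Summit.ABC

end
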